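import Mathlib
import Literature.Dynamics.Contraction.ComplexConeContractionLemma31Proofs
import Summits.CriticalPhenomena.CardyFormulaZ2.Theorems.CardyComplexConeMarkovBlockPresentationRatioLimit
import Summits.CriticalPhenomena.CardyFormulaZ2.Theorems.CardyComplexConeMarkovBlockPresentationReindex

/-!
# Contraction ⇒ coherence: the universal direction of a uniformly Dubois block chain

Helper file for item stmt-CriticalPhenomena-8880 (`MarkovBlockPresentation`, route CardyComplexCone of
`CriticalPhenomena/CardyFormulaZ2`). The item is informal (no Lean signature yet: its part (i), an exact
Markov block presentation of the winding-twisted two-arm observable over collar patterns, is to be typed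
over the vocabulary of `Literature/Probability/Percolation/TwistedArmBlockKernel.lean`, definition request
D1, landed). Its part (ii) "CONTRACTION ⇒ COHERENCE" is, however, a statement of pure linear algebra over
the route's typed engine
`Summit.CriticalPhenomena.CardyFormulaZ2.Theses.CardyComplexCone.ComplexConeContraction`
(item stmt-CriticalPhenomena-8789; Dubois 2009), and this file proves it in abstract form:

`universal_direction` — for an inner-indexed family of block kernels `B k : ℂ^{n(k+1)} → ℂ^{n k}`
satisfying Dubois' four-pattern condition with UNIFORM `(θ, σ)` (the shape of `UniformConeCondition`),
`ComplexConeContraction` yields a functional `u` on test vectors at the innermost level (nonzero on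
`ℂ₊ ∖ {0}`) and constants `C ≥ 0`, `r < 1` — depending on the block family only — such that for every
depth `K ≥ 1`, every trajectory `v` from ANY outer datum `v K ∈ ℂ₊ ∖ {0}` and all test vectors
`f, g ∈ ℂ₊ ∖ {0}`: `‖u g ⟨f, v 0⟩ − u f ⟨g, v 0⟩‖ ≤ C r^K ‖u g‖ ‖⟨f, v 0⟩‖`.
Read with `f, g` = the corner test functions `φ_o, φ_{o'}` (real, nonnegative, hence in `ℂ₊`),
`v K` = the outermost factor (all dependence on the domain, the boundary arcs and the point), and
`K ≈ log_b(dist(z,∂D)/δ)`, this is the projective alignment of the class vector `(E_δ(v, v+o))_o` with the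
universal vector `(u φ_o)_o` at rate `(δ/dist(z,∂D))^{c}`, `c = log(1/r)/log b` — the mechanism the item
describes; combined with an a-priori size bound `‖E_δ‖ = O(δ^{1/3})` (crux `EdgePrecompact` (i)) it gives
the `ε δ^{1/3}` form of `EdgeCoherence` (`universal_direction_of_bound`). `universal_direction_fintype` is
the same statement for kernels `B k : Matrix (α k) (α (k+1)) ℂ` over arbitrary nonempty finite pattern types
(D1's `CollarPattern …` are such), with cone membership spelled out as in the engine.

Proof: reference trajectories `w_K` from the all-ones datum at depth `K` (`exists_traj`); by the
re-indexed engine bound (`inner_bound`, file …Reindex) the ratios `⟨f,w_K⟩/⟨g,w_K⟩` form a ratio-Cauchy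
sequence, hence converge to a nonzero limit `u f / u g` with a uniform relative rate (`ratio_limit_from_one`,
file …RatioLimit); one more application of the engine compares an arbitrary trajectory with `w_K`, and the
two cross-ratios multiply (`norm_mul_sub_one_le`). Read-outs never vanish by Dubois' Lemma 3.1
(`Literature.Dynamics.Contraction.bilinPairing_ne_zero`) and rectangular cone preservation
(`mulVec_mem_rughConeInt_rect`).

References: L. Dubois, J. London Math. Soc. 79 (2009) 719–737 (arXiv:0811.2930), Thm 2.3, Prop. 3.3,
Thm 3.6; H. H. Rugh, Ann. of Math. 171 (2010), Thm 8.4 (the cone `ℂⁿ₊`); for sequential compositions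
Y. Hafouta, Yu. Kifer, *Nonconventional limit theorems and random dynamics* (2018), Part I, Ch. 4–5.
-/

namespace Summit.CriticalPhenomena.CardyFormulaZ2.Theorems.MarkovBlockPresentation

open scoped ComplexConjugate
open Filter Topology Matrix Literature.Dynamics.Contraction
open Summit.CriticalPhenomena.CardyFormulaZ2.Theses.CardyComplexCone (ComplexConeContraction)

section Main

variable {θ σ : ℝ} {n : ℕ → ℕ} {B : (k : ℕ) → Matrix (Fin (n k)) (Fin (n (k + 1))) ℂ}

/-- The constant vector `1` is an admissible outer datum / test vector: it lies in `ℂᵐ₊`. -/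
theorem ones_mem_rughCone (m : ℕ) : (fun _ : Fin m => (1 : ℂ)) ∈ rughCone m :=
  rughConeInt_subset m (one_mem_rughConeInt m)

/-- The constant vector `1` of positive length is nonzero. -/
theorem ones_ne_zero {m : ℕ} (hm : 0 < m) : (fun _ : Fin m => (1 : ℂ)) ≠ 0 := fun h => by
  have h' := congrFun h ⟨0, hm⟩
  simp at h'

/-- Real nonnegative vectors lie in Rugh's cone `ℂᵐ₊` (they form its real sub-cone `ℝᵐ₊`): the corner
test functions `φ_o ≥ 0` of the item are admissible test vectors for `universal_direction`. -/
theorem ofReal_mem_rughCone {m : ℕ} {a : Fin m → ℝ} (ha : ∀ i, 0 ≤ a i) :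
    (fun i => (a i : ℂ)) ∈ rughCone m := by
  intro k l
  rw [Complex.conj_ofReal, ← Complex.ofReal_mul, Complex.ofReal_re]
  exact mul_nonneg (ha k) (ha l)

/-- A real vector that is not identically zero is nonzero as a complex vector. -/
theorem ofReal_ne_zero {ι : Type*} {a : ι → ℝ} (ha : a ≠ 0) : (fun i => (a i : ℂ)) ≠ 0 := by
  obtain ⟨i, hi⟩ := Function.ne_iff.1 ha
  intro h
  have h' := congrFun h i
  simp only [Pi.zero_apply, Complex.ofReal_eq_zero] at h'
  exact hi h'

/-- Real nonnegative vectors over any index type satisfy the spelled-out cone condition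
`Re(a_i · star a_j) ≥ 0` (the form used by the engine and by `universal_direction_fintype`). -/
theorem ofReal_star_re_nonneg {ι : Type*} {a : ι → ℝ} (ha : ∀ i, 0 ≤ a i) (i j : ι) :
    0 ≤ ((a i : ℂ) * star (a j : ℂ)).re := by
  rw [← starRingEnd_apply, Complex.conj_ofReal, ← Complex.ofReal_mul, Complex.ofReal_re]
  exact mul_nonneg (ha i) (ha j)

/-- Read-outs do not vanish: for a depth-`K ≥ 1` trajectory started in `ℂ₊ ∖ {0}` and a test vector
`f ∈ ℂ₊ ∖ {0}` at level `0`, `⟨f, v 0⟩ = ∑ f_i (v 0)_i ≠ 0` (Dubois' Lemma 3.1, `v 0 ∈ Int ℂ₊`). -/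
theorem pairing_ne_zero (hθ0 : 0 < θ) (hθ1 : θ < 1) (hn : ∀ k, 0 < n k)
    (hB : ∀ k a b p q, θ⁻¹ * ‖B k a p * B k b q - B k a q * B k b p‖ <
        (star (B k a p) * B k b q + star (B k a q) * B k b p).re ∧
      ‖B k a p * B k b q‖ ≤ σ ^ 2 * ‖B k a q * B k b p‖)
    {K : ℕ} (hK : 1 ≤ K) {v : (k : ℕ) → Fin (n k) → ℂ} (hv : ∀ k < K, v k = B k *ᵥ v (k + 1))
    (hvc : v K ∈ rughCone (n K)) (hv0 : v K ≠ 0) {f : Fin (n 0) → ℂ} (hfc : f ∈ rughCone (n 0))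
    (hf0 : f ≠ 0) : ∑ i, f i * v 0 i ≠ 0 :=
  bilinPairing_ne_zero hfc hf0 (traj_mem_rughConeInt hθ0 hθ1 hn hB hv hvc hv0 0 hK)

/-- **Contraction ⇒ coherence (abstract form of part (ii) of `MarkovBlockPresentation`).**
Let `B k : ℂ^{n(k+1)} → ℂ^{n k}` (`k ≥ 0`, level `0` innermost, all `n k ≥ 1`) be block kernels
satisfying Dubois' condition with UNIFORM `(θ, σ)` (`0 < θ < 1 ≤ σ`) — the shape of `UniformConeCondition` —
and assume the route's engine `ComplexConeContraction`. Then there are a functional `u` on test vectors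
(the universal direction read through the test vector: `u f = lim_K ⟨f, w_K⟩ / ⟨1, w_K⟩` along the
reference trajectories `w_K` started at the all-ones datum at depth `K`), nonzero on `ℂ₊ ∖ {0}`, and
constants `C ≥ 0`, `r ∈ [0,1)`, all depending on the block family only, such that for EVERY depth
`K ≥ 1`, EVERY trajectory `v` (`v k = B k v (k+1)`, `k < K`) started at ANY outer datum
`v K ∈ ℂ₊ ∖ {0}` (any domain / boundary condition / point), and all test vectors `f, g ∈ ℂ₊ ∖ {0}`:
`‖u g · ⟨f, v 0⟩ − u f · ⟨g, v 0⟩‖ ≤ C r^K ‖u g‖ ‖⟨f, v 0⟩‖` — the read-out vector `(⟨φ_o, v 0⟩)_o` is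
projectively within `C r^K` of the universal vector `(u φ_o)_o`. (In the percolation reading,
`K ≈ log_b (dist(z, ∂D)/δ)`, so `r^K = (δ / dist(z,∂D))^{c}`: coherence with a power-law rate.) -/
theorem universal_direction (hCCC : ComplexConeContraction) (hθ0 : 0 < θ) (hθ1 : θ < 1) (hσ : 1 ≤ σ)
    (hn : ∀ k, 0 < n k)
    (hB : ∀ k a b p q, θ⁻¹ * ‖B k a p * B k b q - B k a q * B k b p‖ <
        (star (B k a p) * B k b q + star (B k a q) * B k b p).re ∧
      ‖B k a p * B k b q‖ ≤ σ ^ 2 * ‖B k a q * B k b p‖) :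
    ∃ (u : (Fin (n 0) → ℂ) → ℂ) (C r : ℝ), 0 ≤ C ∧ 0 ≤ r ∧ r < 1 ∧
      (∀ f, f ∈ rughCone (n 0) → f ≠ 0 → u f ≠ 0) ∧
      ∀ K, 1 ≤ K → ∀ v : (k : ℕ) → Fin (n k) → ℂ, (∀ k < K, v k = B k *ᵥ v (k + 1)) →
      v K ∈ rughCone (n K) → v K ≠ 0 →
      ∀ f g : Fin (n 0) → ℂ, f ∈ rughCone (n 0) → f ≠ 0 → g ∈ rughCone (n 0) → g ≠ 0 →
      ‖u g * (∑ i, f i * v 0 i) - u f * (∑ i, g i * v 0 i)‖ ≤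
        C * r ^ K * (‖u g‖ * ‖∑ i, f i * v 0 i‖) := by
  obtain ⟨C₀, r, hC₀, hr0, hr1, hib⟩ := inner_bound hCCC hθ0 hθ1 hσ hn hB
  have h1r : 0 < 1 - r := by linarith
  -- reference trajectories `w K` started at the all-ones datum at depth `K`
  choose w hwK hw using fun K => exists_traj B K (fun _ => (1 : ℂ))
  have hwc : ∀ K, w K K ∈ rughCone (n K) := fun K => by rw [hwK]; exact ones_mem_rughCone _
  have hw0 : ∀ K, w K K ≠ 0 := fun K => by rw [hwK]; exact ones_ne_zero (hn K)
  -- `w (K+1)` is also a depth-`K` trajectory, started at `B K 1 ∈ ℂ₊ ∖ {0}`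
  have hw' : ∀ K, ∀ k < K, w (K + 1) k = B k *ᵥ w (K + 1) (k + 1) :=
    fun K k hk => hw (K + 1) k (Nat.lt_succ_of_lt hk)
  have hwc' : ∀ K, w (K + 1) K ∈ rughCone (n K) ∧ w (K + 1) K ≠ 0 := fun K =>
    traj_mem_rughCone hθ0 hθ1 hn hB (hw (K + 1)) (hwc (K + 1)) (hw0 (K + 1)) K (Nat.le_succ K)
  -- read-outs of the reference trajectories do not vanish
  have hpw : ∀ K, 1 ≤ K → ∀ f : Fin (n 0) → ℂ, f ∈ rughCone (n 0) → f ≠ 0 →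
      ∑ i, f i * w K 0 i ≠ 0 :=
    fun K hK f hfc hf0 => pairing_ne_zero hθ0 hθ1 hn hB hK (hw K) (hwc K) (hw0 K) hfc hf0
  -- consecutive reference read-out ratios are geometrically close to one
  have hstep : ∀ f g : Fin (n 0) → ℂ, f ∈ rughCone (n 0) → f ≠ 0 → g ∈ rughCone (n 0) → g ≠ 0 →
      ∀ K, 1 ≤ K →
      ‖((∑ i, f i * w (K + 1) 0 i) / (∑ i, g i * w (K + 1) 0 i)) /
          ((∑ i, f i * w K 0 i) / (∑ i, g i * w K 0 i)) - 1‖ ≤ C₀ * r ^ K := by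
    intro f g hfc hf0 hgc hg0 K hK
    have h := hib K hK (w (K + 1)) (w K) (hw' K) (hw K) (hwc' K).1 (hwc' K).2 (hwc K) (hw0 K)
      f g hfc hf0 hgc hg0
    rw [div_div_div_eq, mul_comm (∑ i, g i * w (K + 1) 0 i)]
    exact h
  -- hence the ratios `⟨f, w_K⟩ / ⟨g, w_K⟩` converge to a nonzero limit, with a UNIFORM relative rate
  set D : ℝ := C₀ * Real.exp (C₀ / (1 - r)) / (1 - r) with hD
  have hDnn : 0 ≤ D := by positivity
  have hlim : ∀ f g : Fin (n 0) → ℂ, f ∈ rughCone (n 0) → f ≠ 0 → g ∈ rughCone (n 0) → g ≠ 0 →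
      ∃ ℓ : ℂ, ℓ ≠ 0 ∧
        Tendsto (fun K => (∑ i, f i * w K 0 i) / (∑ i, g i * w K 0 i)) atTop (𝓝 ℓ) ∧
        ∀ K, 1 ≤ K → ‖ℓ / ((∑ i, f i * w K 0 i) / (∑ i, g i * w K 0 i)) - 1‖ ≤ D * r ^ K :=
    fun f g hfc hf0 hgc hg0 =>
      ratio_limit_from_one hC₀ hr0 hr1
        (fun K hK => div_ne_zero (hpw K hK f hfc hf0) (hpw K hK g hgc hg0))
        (hstep f g hfc hf0 hgc hg0)
  -- the universal direction: `u f = lim ⟨f, w_K⟩ / ⟨1, w_K⟩`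
  have hlim1 : ∀ f : Fin (n 0) → ℂ, f ∈ rughCone (n 0) → f ≠ 0 → ∃ ℓ : ℂ, ℓ ≠ 0 ∧
      Tendsto (fun K => (∑ i, f i * w K 0 i) / (∑ i, (fun _ => (1 : ℂ)) i * w K 0 i)) atTop (𝓝 ℓ) :=
    fun f hfc hf0 => by
      obtain ⟨ℓ, hℓ0, hℓ, -⟩ := hlim f (fun _ => 1) hfc hf0 (ones_mem_rughCone _) (ones_ne_zero (hn 0))
      exact ⟨ℓ, hℓ0, hℓ⟩
  choose! u hu0 hu using hlim1
  refine ⟨u, C₀ + D + C₀ * D, r, by positivity, hr0, hr1, hu0, ?_⟩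
  intro K hK v hv hvc hv0 f g hfc hf0 hgc hg0
  -- the four read-outs at hand
  have hEf : ∑ i, f i * v 0 i ≠ 0 := pairing_ne_zero hθ0 hθ1 hn hB hK hv hvc hv0 hfc hf0
  have hEg : ∑ i, g i * v 0 i ≠ 0 := pairing_ne_zero hθ0 hθ1 hn hB hK hv hvc hv0 hgc hg0
  have huf : u f ≠ 0 := hu0 f hfc hf0
  have hug : u g ≠ 0 := hu0 g hgc hg0
  -- the limit of `⟨f,w_K⟩/⟨g,w_K⟩` is `u f / u g`
  obtain ⟨ℓ, hℓ0, hℓ, hℓb⟩ := hlim f g hfc hf0 hgc hg0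
  have hone : ∀ K, 1 ≤ K → ∑ i, (fun _ => (1 : ℂ)) i * w K 0 i ≠ 0 :=
    fun K hK => hpw K hK _ (ones_mem_rughCone _) (ones_ne_zero (hn 0))
  have hℓ' : Tendsto (fun K => (∑ i, f i * w K 0 i) / (∑ i, g i * w K 0 i)) atTop (𝓝 (u f / u g)) := by
    have h := (hu f hfc hf0).div (hu g hgc hg0) hug
    refine h.congr' ?_
    filter_upwards [eventually_ge_atTop 1] with K hK
    rw [Pi.div_apply, div_div_div_cancel_right₀ (hone K hK)]
  have hℓu : ℓ = u f / u g := tendsto_nhds_unique hℓ hℓ'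
  -- the two factors close to one
  have hA : ‖(∑ i, g i * v 0 i) * (∑ i, f i * w K 0 i) /
      ((∑ i, g i * w K 0 i) * (∑ i, f i * v 0 i)) - 1‖ ≤ C₀ * r ^ K :=
    hib K hK v (w K) hv (hw K) hvc hv0 (hwc K) (hw0 K) g f hgc hg0 hfc hf0
  have hBK : ‖(u f / u g) / ((∑ i, f i * w K 0 i) / (∑ i, g i * w K 0 i)) - 1‖ ≤ D * r ^ K := by
    rw [← hℓu]; exact hℓb K hK
  have hprod := norm_mul_sub_one_le hA hBK
  have hfw : ∑ i, f i * w K 0 i ≠ 0 := hpw K hK f hfc hf0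
  have hgw : ∑ i, g i * w K 0 i ≠ 0 := hpw K hK g hgc hg0
  have hid : (∑ i, g i * v 0 i) * (∑ i, f i * w K 0 i) / ((∑ i, g i * w K 0 i) * (∑ i, f i * v 0 i)) *
      ((u f / u g) / ((∑ i, f i * w K 0 i) / (∑ i, g i * w K 0 i))) =
      (u f * ∑ i, g i * v 0 i) / (u g * ∑ i, f i * v 0 i) := by
    field_simp
  rw [hid] at hprod
  -- conclude
  have hx : u g * ∑ i, f i * v 0 i ≠ 0 := mul_ne_zero hug hEf
  have hrK : r ^ K * r ^ K ≤ r ^ K :=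
    mul_le_of_le_one_left (pow_nonneg hr0 K) (pow_le_one₀ hr0 hr1.le)
  calc ‖u g * ∑ i, f i * v 0 i - u f * ∑ i, g i * v 0 i‖
      = ‖u f * ∑ i, g i * v 0 i - u g * ∑ i, f i * v 0 i‖ := norm_sub_rev _ _
    _ ≤ ‖u g * ∑ i, f i * v 0 i‖ * ‖(u f * ∑ i, g i * v 0 i) / (u g * ∑ i, f i * v 0 i) - 1‖ :=
        norm_sub_le_norm_mul_norm_div_sub_one hx
    _ ≤ ‖u g * ∑ i, f i * v 0 i‖ * (C₀ * r ^ K + D * r ^ K + C₀ * r ^ K * (D * r ^ K)) := by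
        gcongr
    _ ≤ ‖u g * ∑ i, f i * v 0 i‖ * ((C₀ + D + C₀ * D) * r ^ K) := by
        gcongr
        have h3 : C₀ * D * (r ^ K * r ^ K) ≤ C₀ * D * r ^ K :=
          mul_le_mul_of_nonneg_left hrK (mul_nonneg hC₀ hDnn)
        nlinarith [h3]
    _ = (C₀ + D + C₀ * D) * r ^ K * (‖u g‖ * ‖∑ i, f i * v 0 i‖) := by rw [norm_mul]; ring

/-- `universal_direction` with an a-priori size bound on the read-outs, in the shape of the crux
`EdgeCoherence`: if moreover `‖⟨f, v 0⟩‖ ≤ M` (in the percolation reading `M = C' δ^{1/3}` is clause (i) of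
`EdgePrecompact`), then `‖u g ⟨f,v 0⟩ − u f ⟨g,v 0⟩‖ ≤ (C ‖u g‖ M) r^K`. -/
theorem universal_direction_of_bound (hCCC : ComplexConeContraction) (hθ0 : 0 < θ) (hθ1 : θ < 1)
    (hσ : 1 ≤ σ) (hn : ∀ k, 0 < n k)
    (hB : ∀ k a b p q, θ⁻¹ * ‖B k a p * B k b q - B k a q * B k b p‖ <
        (star (B k a p) * B k b q + star (B k a q) * B k b p).re ∧
      ‖B k a p * B k b q‖ ≤ σ ^ 2 * ‖B k a q * B k b p‖) :
    ∃ (u : (Fin (n 0) → ℂ) → ℂ) (C r : ℝ), 0 ≤ C ∧ 0 ≤ r ∧ r < 1 ∧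
      (∀ f, f ∈ rughCone (n 0) → f ≠ 0 → u f ≠ 0) ∧
      ∀ K, 1 ≤ K → ∀ v : (k : ℕ) → Fin (n k) → ℂ, (∀ k < K, v k = B k *ᵥ v (k + 1)) →
      v K ∈ rughCone (n K) → v K ≠ 0 →
      ∀ f g : Fin (n 0) → ℂ, f ∈ rughCone (n 0) → f ≠ 0 → g ∈ rughCone (n 0) → g ≠ 0 →
      ∀ M : ℝ, ‖∑ i, f i * v 0 i‖ ≤ M →
      ‖u g * (∑ i, f i * v 0 i) - u f * (∑ i, g i * v 0 i)‖ ≤ C * ‖u g‖ * M * r ^ K := by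
  obtain ⟨u, C, r, hC, hr0, hr1, hu0, hmain⟩ := universal_direction hCCC hθ0 hθ1 hσ hn hB
  refine ⟨u, C, r, hC, hr0, hr1, hu0, ?_⟩
  intro K hK v hv hvc hv0 f g hfc hf0 hgc hg0 M hM
  calc ‖u g * (∑ i, f i * v 0 i) - u f * (∑ i, g i * v 0 i)‖
      ≤ C * r ^ K * (‖u g‖ * ‖∑ i, f i * v 0 i‖) := hmain K hK v hv hvc hv0 f g hfc hf0 hgc hg0
    _ ≤ C * r ^ K * (‖u g‖ * M) := by gcongr
    _ = C * ‖u g‖ * M * r ^ K := by ring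

end Main

section Fintype

/-! ### Pattern spaces as arbitrary finite types

The block kernels of the item are indexed by finite pattern TYPES (D1: `CollarPattern z r C δ`, a
`Fintype`), not by `Fin n`. Dubois' condition, trajectories, cone membership and read-outs are invariant
under re-indexing by the bijections `Fintype.equivFin`, so `universal_direction` transfers verbatim. Cone
membership is spelled out (`∀ k l, 0 ≤ Re(f k · conj (f l))`, written with `star` as in the engine). -/

variable {θ σ : ℝ} {α : ℕ → Type*} [∀ k, Fintype (α k)]
  {B : (k : ℕ) → Matrix (α k) (α (k + 1)) ℂ}

/-- `universal_direction` for block kernels indexed by arbitrary nonempty finite pattern types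
`α k` (level `0` innermost): same conclusion, read-outs `∑ a, f a * v 0 a` over `α 0`. -/
theorem universal_direction_fintype (hCCC : ComplexConeContraction) (hθ0 : 0 < θ) (hθ1 : θ < 1)
    (hσ : 1 ≤ σ) (hne : ∀ k, Nonempty (α k))
    (hB : ∀ k a b p q, θ⁻¹ * ‖B k a p * B k b q - B k a q * B k b p‖ <
        (star (B k a p) * B k b q + star (B k a q) * B k b p).re ∧
      ‖B k a p * B k b q‖ ≤ σ ^ 2 * ‖B k a q * B k b p‖) :
    ∃ (u : (α 0 → ℂ) → ℂ) (C r : ℝ), 0 ≤ C ∧ 0 ≤ r ∧ r < 1 ∧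
      (∀ f : α 0 → ℂ, (∀ a a', 0 ≤ (f a * star (f a')).re) → f ≠ 0 → u f ≠ 0) ∧
      ∀ K, 1 ≤ K → ∀ v : (k : ℕ) → α k → ℂ, (∀ k < K, v k = B k *ᵥ v (k + 1)) →
      (∀ a a', 0 ≤ (v K a * star (v K a')).re) → v K ≠ 0 →
      ∀ f g : α 0 → ℂ, (∀ a a', 0 ≤ (f a * star (f a')).re) → f ≠ 0 →
        (∀ a a', 0 ≤ (g a * star (g a')).re) → g ≠ 0 →
      ‖u g * (∑ a, f a * v 0 a) - u f * (∑ a, g a * v 0 a)‖ ≤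
        C * r ^ K * (‖u g‖ * ‖∑ a, f a * v 0 a‖) := by
  classical
  -- re-index everything by `e k : α k ≃ Fin (n k)`
  let n : ℕ → ℕ := fun k => Fintype.card (α k)
  have hn : ∀ k, 0 < n k := fun k => Fintype.card_pos_iff.2 (hne k)
  let e : (k : ℕ) → α k ≃ Fin (n k) := fun k => Fintype.equivFin (α k)
  let B' : (k : ℕ) → Matrix (Fin (n k)) (Fin (n (k + 1))) ℂ := fun k =>
    Matrix.of fun i j => B k ((e k).symm i) ((e (k + 1)).symm j)
  have hB' : ∀ k a b p q, θ⁻¹ * ‖B' k a p * B' k b q - B' k a q * B' k b p‖ <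
        (star (B' k a p) * B' k b q + star (B' k a q) * B' k b p).re ∧
      ‖B' k a p * B' k b q‖ ≤ σ ^ 2 * ‖B' k a q * B' k b p‖ :=
    fun k a b p q => hB k _ _ _ _
  obtain ⟨u, C, r, hC, hr0, hr1, hu0, hmain⟩ := universal_direction hCCC hθ0 hθ1 hσ hn hB'
  -- transport of vectors: `t ↦ t ∘ (e k)⁻¹`
  have hcone : ∀ {k : ℕ} (t : α k → ℂ), (∀ a a', 0 ≤ (t a * star (t a')).re) →
      (fun i => t ((e k).symm i)) ∈ rughCone (n k) :=
    fun t ht i j => by simpa only [starRingEnd_apply] using ht ((e _).symm i) ((e _).symm j)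
  have hne0 : ∀ {k : ℕ} (t : α k → ℂ), t ≠ 0 → (fun i => t ((e k).symm i)) ≠ 0 := by
    intro k t ht h
    apply ht
    funext a
    have h' := congrFun h (e k a)
    simpa only [Equiv.symm_apply_apply, Pi.zero_apply] using h'
  have hpair : ∀ (t s : α 0 → ℂ),
      ∑ i, (fun i => t ((e 0).symm i)) i * (fun i => s ((e 0).symm i)) i = ∑ a, t a * s a :=
    fun t s => Equiv.sum_comp (e 0).symm (fun a => t a * s a)
  refine ⟨fun f => u (fun i => f ((e 0).symm i)), C, r, hC, hr0, hr1,
    fun f hf hf0 => hu0 _ (hcone f hf) (hne0 f hf0), ?_⟩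
  intro K hK v hv hvc hv0 f g hfc hf0 hgc hg0
  -- the transported trajectory
  let v' : (k : ℕ) → Fin (n k) → ℂ := fun k i => v k ((e k).symm i)
  have hv' : ∀ k < K, v' k = B' k *ᵥ v' (k + 1) := by
    intro k hk
    funext i
    simp only [v', B', Matrix.mulVec, dotProduct, Matrix.of_apply]
    rw [hv k hk]
    simp only [Matrix.mulVec, dotProduct]
    exact (Equiv.sum_comp (e (k + 1)).symm (fun a => B k ((e k).symm i) a * v (k + 1) a)).symm
  have h := hmain K hK v' hv' (hcone (v K) hvc) (hne0 (v K) hv0) (fun i => f ((e 0).symm i))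
    (fun i => g ((e 0).symm i)) (hcone f hfc) (hne0 f hf0) (hcone g hgc) (hne0 g hg0)
  have e1 : ∑ i, (fun i => f ((e 0).symm i)) i * v' 0 i = ∑ a, f a * v 0 a := hpair f (v 0)
  have e2 : ∑ i, (fun i => g ((e 0).symm i)) i * v' 0 i = ∑ a, g a * v 0 a := hpair g (v 0)
  rw [e1, e2] at h
  exact h

end Fintype

end Summit.CriticalPhenomena.CardyFormulaZ2.Theorems.MarkovBlockPresentation
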